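import Literature.NumberTheory.Rogawski1990.ArchSemiregularProperPlaces               -- ★ p850229 (J-DESC) D4a: `uniformlyProper_arch_of_places`, `exists_isCompact_mul_arch_of_places` (brings ★ (W1-cont-Π) `uniformlyProper_circleDiagonal`)
import Literature.NumberTheory.Automorphic.ArchLocalTorusSemiregularProper             -- ★ p850201 (J-DESC) D1c: `uniformlyProper_circleDiagonal_of_ne`, `stabilizer_single_le_centralizer_circleDiagonal`
import Literature.NumberTheory.Automorphic.ArchInnerFormCartanAtlas                    -- ★ `gprimeTorus`, `gprimeBlock`, `gprimeCptGL`, `splitChartPlaces`, `lineOf`, `formSign`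
import HarnessLib

/-!
# Harish-Chandra's compactness lemma for the `G′_∞`-atlas `gprimeTorus α S′` near a SEMI-REGULAR point of a compact-chart place — modulo the centraliser of the wall point
# (Rogawski 1990 §4.12 Lemma 4.12.1, §8.2 pp. 114, 122–123, §4.3; Harish-Chandra–van Dijk 1970 Part I §3 Lemma 22; Deitmar–Echterhoff 2014 Lemma 9.3.3)

Topic `NumberTheory/Rogawski1990`; namespace `Literature.NumberTheory.Rogawski1990`.  THEOREMS ONLY (no `def`, no instance, no notation, no axiom, no named fact, no `sorry`).
Cell `pub/hodgecm-mathlib`, crux H413 (`stmt-HodgeConjecture-24833`), F0∕P3c line LH3 (closer stub `stub_N9`, organ J), brick **(J-DESC) FILE D4b-1** (seat F0P3a-p08 (g22);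
(J-CENSUS) §(i) COMPUTE «descent to `M := Z_{G′}(s)` at `w₀`, other places inert», LH4-p03 (g4)): the ATLAS dress of the compactness lemma, in the tokens of ★
`ArchInnerFormCartanAtlas` (`gprimeTorus L α S′ c = archPiEquivCM⁻¹ (gprimeBlock L α w S′ c)_w`).

THE POINT `p`.  `w₀` a place whose chart is COMPACT (`¬ (w₀ ∈ S′ ∧ w₀ ∈ splitChartPlaces)`: `gprimeBlock = gprimeCptGL (lineOf s) (c w₀) = diag` with the angle `c w₀ k` on the line
`lineOf s k`), `k₀` a slot whose angle is SIMPLE at `p` while the other two slots lie ON a wall (`Circle.exp (p w₀ j) = Circle.exp (p w₀ j′)` for `j, j′ ≠ k₀` — the semi-regular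
points; at a noncompact wall this is the Cayley-point situation of organ J).  Then `M_{w₀} := Z(gprimeBlock p w₀) ≥ Stab(e_{lineOf s k₀})` (★ D1c
`stabilizer_single_le_centralizer_circleDiagonal`) and ★ D1c `uniformlyProper_circleDiagonal_of_ne` gives (HYP) modulo `M_{w₀}` on the parameter set `S_{w₀}` where the slot `k₀`
stays simple — ACROSS the wall.  At the other compact-chart places one feeds ★ (W1-cont-Π) §2 `uniformlyProper_circleDiagonal` on the regular (injective) set modulo
`Z(gprimeBlock p w)`; at the SPLIT places `w ∈ S′ ∩ splitChartPlaces` the per-place (HYP) modulo `Z(gprimeBlock p w)` is TAKEN AS A HYPOTHESIS `hsplit` (the atlas dock of ★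
(W1-cont-Π) §1 `uniformlyProper_centralizer_map_of_diag_hyperbolic` through a frame `e : U(Φ₃)(ℂ) ≃* G′_w`; vacuous for `S′ = ∅`).  ★ D4a assembles, with
`M′ := Z(gprimeTorus p) ↔ Π_w Z(gprimeBlock p w)` (★ `mulEquiv_apply_mem_centralizer_singleton_iff` + «centraliser of a tuple is the product of the centralisers»).
* `gprimeBlock_const`, `gprimeTorus_eq_symm_blockChart` (the atlas chart is the product of the per-place constant-family block charts — definitional bookkeeping);
* `uniformlyProper_gprimeBlock_cpt_of_ne` (place `w₀`, across the wall), `uniformlyProper_gprimeBlock_cpt_of_injective` (other compact-chart places, regular set);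
* **`uniformlyProper_gprimeTorus_of_semireg`** — (HYP) for `c ↦ gprimeTorus L α S′ c` on `Set.pi univ S` modulo `Z(gprimeTorus L α S′ p)`;
* **`exists_isCompact_mul_gprimeTorus_of_semireg`** — group level: ONE compact `C″ ⊆ G′_∞` with `y′ ∈ C″ · Z(gprimeTorus p)` whenever `y′·gprimeTorus c·y′⁻¹ ∈ C′`, `c ∈ K`
  (`K ⊆ Set.pi univ S` compact) — the uniform `hCM` binder of the descent ★ D2∕D3 for the `G′`-atlas.
HONEST LABEL: HC_CM is proved only modulo the 7 printed citations (2 remaining named inputs: hLiu418 = `stmt-HodgeConjecture-24832`, h413 = `stmt-HodgeConjecture-24833`) until rung 0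
closes; count-neutral topology under organ J of `stub_N9`.

## References
* [Rogawski1990] J. D. Rogawski, *Automorphic Representations of Unitary Groups in Three Variables*, Ann. of Math. Stud. 123 (1990), §4.12 Lemma 4.12.1 p. 66, §8.2 p. 114 (the
  compactness lemma), §8.2 pp. 122–123 (the `U(2,1)` walls), §4.3 p. 43 (`G_∞ = Π_w G_w`), §3.6 p. 31.
* [HarishChandra1970] Harish-Chandra (notes by G. van Dijk), *Harmonic Analysis on Reductive p-adic Groups*, LNM 162 (1970), Part I §3 Lemma 22.
* [DeitmarEchterhoff2014] A. Deitmar, S. Echterhoff, *Principles of Harmonic Analysis*, 2nd ed. (2014), Lemma 9.3.3, Remark 1.5.2.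
* [Shelstad1979] D. Shelstad, *Characters and inner forms of a quasi-split group over ℝ*, Compositio Math. 39 (1979), §4 pp. 22–25.
-/

set_option autoImplicit false

noncomputable section

open MeasureTheory Set Topology NumberField NumberField.InfinitePlace
open Literature.MeasureTheory.Group Literature.NumberTheory.Automorphic Literature.NumberTheory.Automorphic.UnitaryGroup
open scoped MatrixGroups Matrix Pointwise

namespace Literature.NumberTheory.Rogawski1990

section Atlas

variable (L : Type) [Field L] [NumberField L] [IsCMField L] (α : Fin 3 → L) (S' : Finset {w : InfinitePlace L // IsComplex w})

omit [NumberField L] [IsCMField L] in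
/-- The place component reads only `c w`: the block of the constant family `fun _ => c w` is the block of `c` (definitional). [cite: Rogawski1990, §3.6 p. 31] -/
theorem gprimeBlock_const (w : {w : InfinitePlace L // IsComplex w}) (c : {w : InfinitePlace L // IsComplex w} → Fin 3 → ℝ) :
    gprimeBlock L α w S' (fun _ => c w) = gprimeBlock L α w S' c := rfl

/-- **The atlas chart is the product of the per-place block charts**: `gprimeTorus α S′ c = archPiEquivCM⁻¹ (w ↦ gprimeBlock α w S′ (fun _ ↦ c w))` (definitional).
[cite: Rogawski1990, §4.3 p. 43; §3.6 p. 31] -/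
theorem gprimeTorus_eq_symm_blockChart (c : {w : InfinitePlace L // IsComplex w} → Fin 3 → ℝ) :
    gprimeTorus L α S' c = (archPiEquivCM 3 L (Matrix.diagonal α)).symm (fun w => gprimeBlock L α w S' (fun _ => c w)) := rfl

omit [NumberField L] [IsCMField L] in
/-- At a compact-chart place the block chart is the circle-torus chart re-parametrised by the angles: `gprimeBlock α w S′ (fun _ ↦ cw) = diag(ℓ ↦ e^{i cw (τ⁻¹ ℓ)})`,
`τ = lineOf (formSign L α w)`. [cite: Rogawski1990, §3.6 p. 31] -/
theorem gprimeBlock_const_eq_circleDiagonal {w : {w : InfinitePlace L // IsComplex w}} (hw : ¬ (w ∈ S' ∧ w ∈ splitChartPlaces L α)) (cw : Fin 3 → ℝ) :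
    gprimeBlock L α w S' (fun _ => cw) =
      ⟨circleDiagonal 3 fun ℓ => Circle.exp (cw ((lineOf (formSign L α w)).symm ℓ)), circleDiagonal_mem_archLocal_diagonal L 3 α w _⟩ := by
  apply Subtype.ext
  unfold gprimeBlock
  rw [dif_neg hw]
  rfl

omit [NumberField L] [IsCMField L] in
/-- **(HYP) AT THE SEMI-REGULAR PLACE `w₀`, ACROSS THE WALL**: the compact block chart `cw ↦ gprimeBlock α w₀ S′ (fun _ ↦ cw)` is uniformly proper modulo any
`M ≥ Stab(e_{lineOf s k₀})` on the set where the slot `k₀` is simple (`Circle.exp (cw k₀) ≠ Circle.exp (cw j)`, `j ≠ k₀`; the other two slots free to collide) — ★ D1c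
`uniformlyProper_circleDiagonal_of_ne` re-parametrised by the angles (★ `uniformlyProper_comp`). [cite: Rogawski1990, §4.12 Lemma 4.12.1 p. 66; §8.2 pp. 122–123] [cite: HarishChandra1970, Part I §3 Lemma 22] -/
theorem uniformlyProper_gprimeBlock_cpt_of_ne (hα : ∀ i, α i ≠ 0) {w : {w : InfinitePlace L // IsComplex w}} (hreal : ∀ i, (w.1.embedding (α i)).im = 0)
    (hw : ¬ (w ∈ S' ∧ w ∈ splitChartPlaces L α)) (k₀ : Fin 3)
    (M : Subgroup ↥(archLocal L 3 (Matrix.diagonal α) w))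
    (hM : MulAction.stabilizer ↥(archLocal L 3 (Matrix.diagonal α) w) (Pi.single (lineOf (formSign L α w) k₀) (1 : ℂ) : Fin 3 → ℂ) ≤ M) :
    ∀ K ⊆ {cw : Fin 3 → ℝ | ∀ j, j ≠ k₀ → Circle.exp (cw k₀) ≠ Circle.exp (cw j)}, IsCompact K → ∀ C : Set ↥(archLocal L 3 (Matrix.diagonal α) w), IsCompact C →
      ∃ 𝒦 : Set (↥(archLocal L 3 (Matrix.diagonal α) w) ⧸ M), IsCompact 𝒦 ∧
        ∀ cw ∈ K, ∀ y : ↥(archLocal L 3 (Matrix.diagonal α) w), y * gprimeBlock L α w S' (fun _ => cw) * y⁻¹ ∈ C →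
          (QuotientGroup.mk y : ↥(archLocal L 3 (Matrix.diagonal α) w) ⧸ M) ∈ 𝒦 := by
  have hd : Continuous fun cw : Fin 3 → ℝ => fun ℓ : Fin 3 => Circle.exp (cw ((lineOf (formSign L α w)).symm ℓ)) :=
    continuous_pi fun ℓ => Circle.exp.continuous.comp (continuous_apply _)
  have hmaps : Set.MapsTo (fun cw : Fin 3 → ℝ => fun ℓ : Fin 3 => Circle.exp (cw ((lineOf (formSign L α w)).symm ℓ)))
      {cw : Fin 3 → ℝ | ∀ j, j ≠ k₀ → Circle.exp (cw k₀) ≠ Circle.exp (cw j)}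
      {z : Fin 3 → Circle | ∀ ℓ, ℓ ≠ lineOf (formSign L α w) k₀ → z (lineOf (formSign L α w) k₀) ≠ z ℓ} := by
    intro cw hcw ℓ hℓ
    dsimp only
    rw [Equiv.symm_apply_apply]
    exact hcw _ fun h => hℓ (by rw [← h, Equiv.apply_symm_apply])
  have h := uniformlyProper_comp M _ (uniformlyProper_circleDiagonal_of_ne L 3 α w hα hreal (lineOf (formSign L α w) k₀) M hM) hd hmaps
  have hfun : ((fun z : Fin 3 → Circle => (⟨circleDiagonal 3 z, circleDiagonal_mem_archLocal_diagonal L 3 α w z⟩ : ↥(archLocal L 3 (Matrix.diagonal α) w))) ∘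
      fun cw : Fin 3 → ℝ => fun ℓ : Fin 3 => Circle.exp (cw ((lineOf (formSign L α w)).symm ℓ))) =
      fun cw : Fin 3 → ℝ => gprimeBlock L α w S' (fun _ => cw) := by
    funext cw
    rw [gprimeBlock_const_eq_circleDiagonal L α S' hw cw]
    rfl
  rw [hfun] at h
  exact h

omit [NumberField L] [IsCMField L] in
/-- **(HYP) AT A COMPACT-CHART PLACE ON THE REGULAR SET** (injective angles), modulo ANY subgroup — ★ (W1-cont-Π) `uniformlyProper_circleDiagonal` re-parametrised by the
angles. [cite: Rogawski1990, §8.3 p. 122; §3.6 p. 31] [cite: DeitmarEchterhoff2014, Lemma 9.3.3] -/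
theorem uniformlyProper_gprimeBlock_cpt_of_injective (hα : ∀ i, α i ≠ 0) {w : {w : InfinitePlace L // IsComplex w}}
    (hw : ¬ (w ∈ S' ∧ w ∈ splitChartPlaces L α)) (M : Subgroup ↥(archLocal L 3 (Matrix.diagonal α) w)) :
    ∀ K ⊆ {cw : Fin 3 → ℝ | Function.Injective fun i : Fin 3 => Circle.exp (cw i)}, IsCompact K →
      ∀ C : Set ↥(archLocal L 3 (Matrix.diagonal α) w), IsCompact C →
        ∃ 𝒦 : Set (↥(archLocal L 3 (Matrix.diagonal α) w) ⧸ M), IsCompact 𝒦 ∧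
          ∀ cw ∈ K, ∀ y : ↥(archLocal L 3 (Matrix.diagonal α) w), y * gprimeBlock L α w S' (fun _ => cw) * y⁻¹ ∈ C →
            (QuotientGroup.mk y : ↥(archLocal L 3 (Matrix.diagonal α) w) ⧸ M) ∈ 𝒦 := by
  have hd : Continuous fun cw : Fin 3 → ℝ => fun ℓ : Fin 3 => Circle.exp (cw ((lineOf (formSign L α w)).symm ℓ)) :=
    continuous_pi fun ℓ => Circle.exp.continuous.comp (continuous_apply _)
  have hmaps : Set.MapsTo (fun cw : Fin 3 → ℝ => fun ℓ : Fin 3 => Circle.exp (cw ((lineOf (formSign L α w)).symm ℓ)))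
      {cw : Fin 3 → ℝ | Function.Injective fun i : Fin 3 => Circle.exp (cw i)} {z : Fin 3 → Circle | Function.Injective z} := by
    intro cw hcw
    exact hcw.comp (lineOf (formSign L α w)).symm.injective
  have h := uniformlyProper_comp M _ (uniformlyProper_circleDiagonal L 3 α w hα M) hd hmaps
  have hfun : ((fun z : Fin 3 → Circle => (⟨circleDiagonal 3 z, circleDiagonal_mem_archLocal_diagonal L 3 α w z⟩ : ↥(archLocal L 3 (Matrix.diagonal α) w))) ∘
      fun cw : Fin 3 → ℝ => fun ℓ : Fin 3 => Circle.exp (cw ((lineOf (formSign L α w)).symm ℓ))) =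
      fun cw : Fin 3 → ℝ => gprimeBlock L α w S' (fun _ => cw) := by
    funext cw
    rw [gprimeBlock_const_eq_circleDiagonal L α S' hw cw]
    rfl
  rw [hfun] at h
  exact h

omit [NumberField L] [IsCMField L] in
/-- `Stab(e_{lineOf s k₀}) ≤ Z(gprimeBlock p w₀)` when the two slots other than `k₀` lie ON a wall at `w₀` (the semi-regular points). [cite: Rogawski1990, §8.2 pp. 122–123] -/
theorem stabilizer_single_le_centralizer_gprimeBlock_of_wall (hα : ∀ i, α i ≠ 0) {w : {w : InfinitePlace L // IsComplex w}}
    (hreal : ∀ i, (w.1.embedding (α i)).im = 0) (hw : ¬ (w ∈ S' ∧ w ∈ splitChartPlaces L α)) (k₀ : Fin 3)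
    (p : {w : InfinitePlace L // IsComplex w} → Fin 3 → ℝ) (hwall : ∀ j j', j ≠ k₀ → j' ≠ k₀ → Circle.exp (p w j) = Circle.exp (p w j')) :
    MulAction.stabilizer ↥(archLocal L 3 (Matrix.diagonal α) w) (Pi.single (lineOf (formSign L α w) k₀) (1 : ℂ) : Fin 3 → ℂ) ≤
      Subgroup.centralizer ({gprimeBlock L α w S' p} : Set ↥(archLocal L 3 (Matrix.diagonal α) w)) := by
  -- a slot `j₁ ≠ k₀` to name the common value on the wall
  obtain ⟨j₁, hj₁⟩ : ∃ j₁ : Fin 3, j₁ ≠ k₀ := ⟨k₀ + 1, by simp⟩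
  rw [← gprimeBlock_const L α S' w p, gprimeBlock_const_eq_circleDiagonal L α S' hw (p w)]
  refine stabilizer_single_le_centralizer_circleDiagonal L 3 α w hα hreal (lineOf (formSign L α w) k₀)
    (ζ := Circle.exp (p w j₁)) fun ℓ hℓ => ?_
  exact hwall _ _ (fun h => hℓ (by rw [← h, Equiv.apply_symm_apply])) hj₁

/-- **HARISH-CHANDRA'S COMPACTNESS LEMMA FOR THE ATLAS `gprimeTorus α S′` NEAR A SEMI-REGULAR COMPACT-WALL POINT ((HYP) form).**  `p` a point which at the compact-chart
place `w₀` has the slot `k₀` SIMPLE and the other two slots ON a wall; per-place parameter sets `S w` with: at `w₀`, `S w₀ ⊆ {slot k₀ simple}`; at the other compact-chart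
places, `S w ⊆ {injective angles}`; at the split places `w ∈ S′ ∩ splitChartPlaces` the (HYP) modulo `Z(gprimeBlock p w)` on `S w` is the hypothesis `hsplit`.  Then the atlas
chart `c ↦ gprimeTorus L α S′ c` is UNIFORMLY PROPER MODULO `Z(gprimeTorus L α S′ p)` on `Set.pi univ S` — the (HYP) binder of ★ `continuousOn_integral_descConj_of_uniformlyProper`
verbatim.  (★ D4a over ★ D1c at `w₀` and ★ (W1-cont-Π) §2 elsewhere; `Z(gprimeTorus p) ↔ Π_w Z(gprimeBlock p w)` by ★ `mulEquiv_apply_mem_centralizer_singleton_iff`.)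
[cite: Rogawski1990, §4.12 Lemma 4.12.1 p. 66; §8.2 p. 114; §4.3 p. 43] [cite: HarishChandra1970, Part I §3 Lemma 22] [cite: DeitmarEchterhoff2014, Lemma 9.3.3] -/
theorem uniformlyProper_gprimeTorus_of_semireg (hα : ∀ i, α i ≠ 0)
    (hreal : ∀ (w : {w : InfinitePlace L // IsComplex w}) (i : Fin 3), (w.1.embedding (α i)).im = 0)
    (p : {w : InfinitePlace L // IsComplex w} → Fin 3 → ℝ) (w₀ : {w : InfinitePlace L // IsComplex w}) (hw₀ : ¬ (w₀ ∈ S' ∧ w₀ ∈ splitChartPlaces L α)) (k₀ : Fin 3)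
    (hwall : ∀ j j', j ≠ k₀ → j' ≠ k₀ → Circle.exp (p w₀ j) = Circle.exp (p w₀ j'))
    (S : {w : InfinitePlace L // IsComplex w} → Set (Fin 3 → ℝ))
    (hS₀ : S w₀ ⊆ {cw : Fin 3 → ℝ | ∀ j, j ≠ k₀ → Circle.exp (cw k₀) ≠ Circle.exp (cw j)})
    (hScpt : ∀ w, w ≠ w₀ → ¬ (w ∈ S' ∧ w ∈ splitChartPlaces L α) → S w ⊆ {cw : Fin 3 → ℝ | Function.Injective fun i : Fin 3 => Circle.exp (cw i)})
    (hsplit : ∀ w, w ∈ S' ∧ w ∈ splitChartPlaces L α →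
      ∀ K ⊆ S w, IsCompact K → ∀ C : Set ↥(archLocal L 3 (Matrix.diagonal α) w), IsCompact C →
        ∃ 𝒦 : Set (↥(archLocal L 3 (Matrix.diagonal α) w) ⧸ Subgroup.centralizer ({gprimeBlock L α w S' p} : Set ↥(archLocal L 3 (Matrix.diagonal α) w))),
          IsCompact 𝒦 ∧ ∀ cw ∈ K, ∀ y : ↥(archLocal L 3 (Matrix.diagonal α) w), y * gprimeBlock L α w S' (fun _ => cw) * y⁻¹ ∈ C →
            (QuotientGroup.mk y : ↥(archLocal L 3 (Matrix.diagonal α) w) ⧸ Subgroup.centralizer ({gprimeBlock L α w S' p} : Set ↥(archLocal L 3 (Matrix.diagonal α) w))) ∈ 𝒦) :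
    ∀ K ⊆ Set.pi Set.univ S, IsCompact K →
      ∀ C' : Set ↥(arch (↥(maximalRealSubfield L)) L (IsCMField.complexConj L) 3 (Matrix.diagonal α)), IsCompact C' →
        ∃ 𝒦' : Set (↥(arch (↥(maximalRealSubfield L)) L (IsCMField.complexConj L) 3 (Matrix.diagonal α)) ⧸
            Subgroup.centralizer ({gprimeTorus L α S' p} : Set ↥(arch (↥(maximalRealSubfield L)) L (IsCMField.complexConj L) 3 (Matrix.diagonal α)))),
          IsCompact 𝒦' ∧ ∀ c ∈ K, ∀ y' : ↥(arch (↥(maximalRealSubfield L)) L (IsCMField.complexConj L) 3 (Matrix.diagonal α)),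
            y' * gprimeTorus L α S' c * y'⁻¹ ∈ C' →
              (QuotientGroup.mk y' : ↥(arch (↥(maximalRealSubfield L)) L (IsCMField.complexConj L) 3 (Matrix.diagonal α)) ⧸
                Subgroup.centralizer ({gprimeTorus L α S' p} : Set ↥(arch (↥(maximalRealSubfield L)) L (IsCMField.complexConj L) 3 (Matrix.diagonal α)))) ∈ 𝒦' := by
  -- `Z(gprimeTorus p) ↔ Π_w Z(gprimeBlock p w)` under `archPiEquivCM`
  have hMM' : ∀ g : ∀ w : {w : InfinitePlace L // IsComplex w}, ↥(archLocal L 3 (Matrix.diagonal α) w),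
      (archPiEquivCM 3 L (Matrix.diagonal α)).symm g ∈
          Subgroup.centralizer ({gprimeTorus L α S' p} : Set ↥(arch (↥(maximalRealSubfield L)) L (IsCMField.complexConj L) 3 (Matrix.diagonal α))) ↔
        g ∈ Subgroup.pi Set.univ fun w => Subgroup.centralizer ({gprimeBlock L α w S' p} : Set ↥(archLocal L 3 (Matrix.diagonal α) w)) :=
    fun g => by
      rw [gprimeTorus, show ((archPiEquivCM 3 L (Matrix.diagonal α)).symm g) = (archPiEquivCM 3 L (Matrix.diagonal α)).symm.toMulEquiv g from rfl,
        show ((archPiEquivCM 3 L (Matrix.diagonal α)).symm fun w => gprimeBlock L α w S' p) =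
          (archPiEquivCM 3 L (Matrix.diagonal α)).symm.toMulEquiv (fun w => gprimeBlock L α w S' p) from rfl,
        mulEquiv_apply_mem_centralizer_singleton_iff, Subgroup.mem_centralizer_singleton_iff, Subgroup.mem_pi]
      simp only [Set.mem_univ, true_imp_iff, Subgroup.mem_centralizer_singleton_iff]
      exact ⟨fun h w => congrFun h w, fun h => funext h⟩
  -- per-place (HYP)
  have hprop : ∀ w : {w : InfinitePlace L // IsComplex w}, ∀ K ⊆ S w, IsCompact K → ∀ C : Set ↥(archLocal L 3 (Matrix.diagonal α) w), IsCompact C →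
      ∃ 𝒦 : Set (↥(archLocal L 3 (Matrix.diagonal α) w) ⧸ Subgroup.centralizer ({gprimeBlock L α w S' p} : Set ↥(archLocal L 3 (Matrix.diagonal α) w))),
        IsCompact 𝒦 ∧ ∀ cw ∈ K, ∀ y : ↥(archLocal L 3 (Matrix.diagonal α) w), y * gprimeBlock L α w S' (fun _ => cw) * y⁻¹ ∈ C →
          (QuotientGroup.mk y : ↥(archLocal L 3 (Matrix.diagonal α) w) ⧸ Subgroup.centralizer ({gprimeBlock L α w S' p} : Set ↥(archLocal L 3 (Matrix.diagonal α) w))) ∈ 𝒦 := by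
    intro w
    by_cases hws : w ∈ S' ∧ w ∈ splitChartPlaces L α
    · exact hsplit w hws
    · by_cases hw0 : w = w₀
      · subst hw0
        exact uniformlyProper_mono _ _ hS₀ (uniformlyProper_gprimeBlock_cpt_of_ne L α S' hα (hreal w) hws k₀ _
          (stabilizer_single_le_centralizer_gprimeBlock_of_wall L α S' hα (hreal w) hws k₀ p hwall))
      · exact uniformlyProper_mono _ _ (hScpt w hw0 hws) (uniformlyProper_gprimeBlock_cpt_of_injective L α S' hα hws _)
  exact uniformlyProper_arch_of_places L 3 (Matrix.diagonal α) (fun w => Subgroup.centralizer ({gprimeBlock L α w S' p} : Set ↥(archLocal L 3 (Matrix.diagonal α) w)))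
    (Subgroup.centralizer ({gprimeTorus L α S' p} : Set _)) hMM' (fun w cw => gprimeBlock L α w S' (fun _ => cw)) S hprop

/-- **Group-level form** (the uniform `hCM` binder of ★ D2 `exists_descended_forall_orbitalIntegral_eq` ∕ ★ D3 `integral_descConj_eq_integral_descConj_descended` on `G′_∞`): for
`K ⊆ Set.pi univ S` compact and `C′ ⊆ G′_∞` compact, ONE compact `C″` with `y′ ∈ C″ · Z(gprimeTorus p)` whenever `y′·gprimeTorus c·y′⁻¹ ∈ C′` for some `c ∈ K`.
[cite: Rogawski1990, §4.12 Lemma 4.12.1 p. 66; §8.2 p. 114] [cite: HarishChandra1970, Part I §3 Lemma 22] [cite: DeitmarEchterhoff2014, Remark 1.5.2] -/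
theorem exists_isCompact_mul_gprimeTorus_of_semireg (hα : ∀ i, α i ≠ 0)
    (hreal : ∀ (w : {w : InfinitePlace L // IsComplex w}) (i : Fin 3), (w.1.embedding (α i)).im = 0)
    (p : {w : InfinitePlace L // IsComplex w} → Fin 3 → ℝ) (w₀ : {w : InfinitePlace L // IsComplex w}) (hw₀ : ¬ (w₀ ∈ S' ∧ w₀ ∈ splitChartPlaces L α)) (k₀ : Fin 3)
    (hwall : ∀ j j', j ≠ k₀ → j' ≠ k₀ → Circle.exp (p w₀ j) = Circle.exp (p w₀ j'))
    (S : {w : InfinitePlace L // IsComplex w} → Set (Fin 3 → ℝ))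
    (hS₀ : S w₀ ⊆ {cw : Fin 3 → ℝ | ∀ j, j ≠ k₀ → Circle.exp (cw k₀) ≠ Circle.exp (cw j)})
    (hScpt : ∀ w, w ≠ w₀ → ¬ (w ∈ S' ∧ w ∈ splitChartPlaces L α) → S w ⊆ {cw : Fin 3 → ℝ | Function.Injective fun i : Fin 3 => Circle.exp (cw i)})
    (hsplit : ∀ w, w ∈ S' ∧ w ∈ splitChartPlaces L α →
      ∀ K ⊆ S w, IsCompact K → ∀ C : Set ↥(archLocal L 3 (Matrix.diagonal α) w), IsCompact C →
        ∃ 𝒦 : Set (↥(archLocal L 3 (Matrix.diagonal α) w) ⧸ Subgroup.centralizer ({gprimeBlock L α w S' p} : Set ↥(archLocal L 3 (Matrix.diagonal α) w))),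
          IsCompact 𝒦 ∧ ∀ cw ∈ K, ∀ y : ↥(archLocal L 3 (Matrix.diagonal α) w), y * gprimeBlock L α w S' (fun _ => cw) * y⁻¹ ∈ C →
            (QuotientGroup.mk y : ↥(archLocal L 3 (Matrix.diagonal α) w) ⧸ Subgroup.centralizer ({gprimeBlock L α w S' p} : Set ↥(archLocal L 3 (Matrix.diagonal α) w))) ∈ 𝒦)
    {K : Set ({w : InfinitePlace L // IsComplex w} → Fin 3 → ℝ)} (hKS : K ⊆ Set.pi Set.univ S) (hK : IsCompact K)
    {C' : Set ↥(arch (↥(maximalRealSubfield L)) L (IsCMField.complexConj L) 3 (Matrix.diagonal α))} (hC' : IsCompact C') :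
    ∃ C'' : Set ↥(arch (↥(maximalRealSubfield L)) L (IsCMField.complexConj L) 3 (Matrix.diagonal α)), IsCompact C'' ∧
      ∀ c ∈ K, ∀ y' : ↥(arch (↥(maximalRealSubfield L)) L (IsCMField.complexConj L) 3 (Matrix.diagonal α)),
        y' * gprimeTorus L α S' c * y'⁻¹ ∈ C' →
          y' ∈ C'' * (Subgroup.centralizer ({gprimeTorus L α S' p} : Set ↥(arch (↥(maximalRealSubfield L)) L (IsCMField.complexConj L) 3 (Matrix.diagonal α))) :
            Set ↥(arch (↥(maximalRealSubfield L)) L (IsCMField.complexConj L) 3 (Matrix.diagonal α))) := by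
  obtain ⟨𝒦', h𝒦', hmem⟩ := uniformlyProper_gprimeTorus_of_semireg L α S' hα hreal p w₀ hw₀ k₀ hwall S hS₀ hScpt hsplit K hKS hK C' hC'
  obtain ⟨C'', hC'', hsub⟩ := exists_isCompact_image_mk_superset
    (Subgroup.centralizer ({gprimeTorus L α S' p} : Set ↥(arch (↥(maximalRealSubfield L)) L (IsCMField.complexConj L) 3 (Matrix.diagonal α)))) h𝒦'
  refine ⟨C'', hC'', fun c hc y' hy' => ?_⟩
  obtain ⟨a, ha, hay⟩ := hsub (hmem c hc y' hy')
  rw [QuotientGroup.eq] at hay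
  exact ⟨a, ha, a⁻¹ * y', hay, by group⟩

end Atlas

end Literature.NumberTheory.Rogawski1990
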